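import Literature.AlgebraicGeometry.Motives.AbelianVarietyTateModuleTraceDimensionFormula
import Literature.AlgebraicGeometry.Motives.AbelianVarietyImageRestrict
import Literature.AlgebraicGeometry.Motives.AbelianVarietyEpiTateSurjective
import HarnessLib

/-!
# The image of a quasi-idempotent endomorphism, read on DUAL rational Tate modules: `ᵗV_ℓ(X ↠ Im u)` identifies
# `(V_ℓ Im u)^∨` with the `a`-eigenspace of `ᵗV_ℓ(u)` on `(V_ℓ X)^∨`, equivariantly for endomorphisms commuting with `u`

Topic `AlgebraicGeometry/Motives`; namespace `Literature.AlgebraicGeometry.Motives.AbelianVariety`.  THEOREMS ONLY (no definition, no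
named fact, no instance, no `sorry`), assembled from landed tree API: ★ `AbelianVarietyImage` (`image u`, `toImage u : X ⟶ Im u`,
`imageι u : Im u ⟶ X`, `toImage_imageι`), ★ `AbelianVarietyIdempotentRelations`/`…TateModuleTraceDimensionFormula` §QuasiIdempotent
(`imageι_comp_toImage_eq_nsmul : ι ≫ ū = a • 𝟙` for `u ≫ u = a • u`), ★ `AbelianVarietyImageRestrict` (`imageRestrict`,
`toImage_imageRestrict`, `imageRestrict_ι`), ★ `TateAbelianFiniteSteps`/`AbelianVarietyEpiTateSurjective` (`V_ℓ` functoriality,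
`rationalTateModuleMap_comp_of_comp_eq_nsmul`).

## Mathematics

Let `u : X ⟶ X` be a QUASI-IDEMPOTENT endomorphism of an abelian variety over a field, `u ≫ u = a • u` with `a ≠ 0` (the integral form
of the rational idempotent `e = u/a ∈ End⁰(X)`), `ū : X ↠ Im u`, `ι : Im u ↪ X` (`ū ≫ ι = u`, `ι ≫ ū = [a]`).  On rational Tate modules
`V_ℓ ū ∘ V_ℓ ι = a` and `V_ℓ ι ∘ V_ℓ ū = V_ℓ u`; hence `V_ℓ ū` is surjective, `ᵗV_ℓ ū : (V_ℓ Im u)^∨ → (V_ℓ X)^∨` is injective, and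
its range is EXACTLY the `a`-eigenspace of `ᵗV_ℓ u` — the linear forms `g` with `g ∘ V_ℓ u = a·g`, i.e. `g ∘ V_ℓ(1 − e) = 0`
(`range_dualMap_rationalTateModuleMap_toImage`).  For an endomorphism `b` commuting with `u`, its restriction `b|_{Im u}`
(`imageRestrict u b b _`) satisfies `ᵗV_ℓ ū ∘ ᵗV_ℓ(b|) = ᵗV_ℓ b ∘ ᵗV_ℓ ū`; consequently (after any base change `R ⊗_{ℚ_ℓ} −`) a class
`G ∈ R ⊗ (V_ℓ X)^∨` in the `a`-eigenspace of `1 ⊗ ᵗV_ℓ u` is `(1 ⊗ ᵗV_ℓ ū) F` for `F := a⁻¹ · (1 ⊗ ᵗV_ℓ ι) G`, and every eigen-relation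
`(1 ⊗ ᵗV_ℓ b) G = c • G` descends to `(1 ⊗ ᵗV_ℓ(b|)) F = c • F` (`exists_eq_dualMap_toImage_baseChange_of_mem_eigenspace`).

DICTIONARY LINE (cell `hodgecm-mathlib`, crux `HLiu418` = stmt-HodgeConjecture-24832, d6 HOME card `A-plan/d6/D6-LINE-CARD.A-plan2g11.md`
S2 `stub_d6_cmIsotypicQuotient`, lever (J1a) «idempotent quotient»): with `X := C.A K` (Albanese of a level of the curve tower),
`u := a · e_lab` the integral multiple of the `ω⋆_lab`-Hecke idempotent (u1 projectors), `B := image u`, `φ := toImage u`: an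
`ω⋆_lab`-Hom value at level `K` that is `a`-eigen for `1 ⊗ ᵗV_ℓ u` (isotypy, S1 territory) IS `(1 ⊗ ᵗV_ℓ φ) F` with `F` inheriting every
Hecke eigen-relation through `imageRestrict` — the `(φ, f)` input of ★ `Sec42Data.exists_heckeCharacter_towerRep_eq_inv_smul_of_ringHom'`
(`Liu2021/AppendixC/EtaleH1TowerCMQuotient`, edition 2).  [Liu2021] §D.4 l. 5626: «Using Hecke operators, we may find a surjective
homomorphism `φ : A_K → B` … such that `φ^* : H¹_B(B, ℚ) → H¹_B(A_K, ℚ)[π̲^∞]` is an isomorphism».  The file moves no book (HC_CM is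
proved only modulo the 7 printed citations until rung 0 closes).

## References
* [MumfordAV1970] D. Mumford, *Abelian Varieties* (1970), §19 Thm. 1 (p. 173) and Thm. 3 (p. 176) (`V_ℓ`, images of endomorphisms).
* [Liu2021] Y. Liu, *Fourier–Jacobi cycles and arithmetic relative trace formula*, Camb. J. Math. 9 (2021), App. D §D.4 (FJcycle.tex
  l. 5626–5627).
* [DokchitserEtAl2022] (as cited by ★ `AbelianVarietyTateModuleTraceDimensionFormula`): §3, the additive-functor lemma for `F = V_ℓ`.
-/

set_option autoImplicit false

noncomputable section

open CategoryTheory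
open scoped TensorProduct

universe u

namespace Literature.AlgebraicGeometry.Motives

namespace AbelianVariety

variable {K : Type u} [Field K] (ℓ : ℕ) [Fact ℓ.Prime] {X : AbelianVariety K} {u : X ⟶ X} {a : ℕ}

/-! ## §1 `V_ℓ` of the factorisation `u = (X ↠ Im u ↪ X)` -/

/-- `V_ℓ ι ∘ V_ℓ ū = V_ℓ u` (`ū ≫ ι = u`, functoriality of `V_ℓ`). [cite: MumfordAV1970, §19 Thm. 3 (p. 176)] -/
theorem rationalTateModuleMap_imageι_comp_toImage (u : X ⟶ X) :
    rationalTateModuleMap ℓ (imageι u) ∘ₗ rationalTateModuleMap ℓ (toImage u) = rationalTateModuleMap ℓ u := by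
  rw [← rationalTateModuleMap_comp, toImage_imageι]

/-- `V_ℓ ū ∘ V_ℓ ι = a` on `V_ℓ(Im u)` for a quasi-idempotent `u ≫ u = a • u` (`ι ≫ ū = a • 𝟙`).
[cite: MumfordAV1970, §19 Thm. 3 (p. 176)] -/
theorem rationalTateModuleMap_toImage_comp_imageι (hu : u ≫ u = a • u) :
    rationalTateModuleMap ℓ (toImage u) ∘ₗ rationalTateModuleMap ℓ (imageι u) =
      (a : ℚ_[ℓ]) • (LinearMap.id : (image u).rationalTateModule ℓ →ₗ[ℚ_[ℓ]] _) := by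
  rw [rationalTateModuleMap_comp_of_comp_eq_nsmul ℓ (imageι_comp_toImage_eq_nsmul hu), Nat.cast_smul_eq_nsmul]

/-- `V_ℓ ū ∘ V_ℓ u = a · V_ℓ ū` (`V_ℓ u = V_ℓ ι ∘ V_ℓ ū` and `V_ℓ ū ∘ V_ℓ ι = a`). [cite: MumfordAV1970, §19 Thm. 3 (p. 176)] -/
theorem rationalTateModuleMap_toImage_comp_self (hu : u ≫ u = a • u) :
    rationalTateModuleMap ℓ (toImage u) ∘ₗ rationalTateModuleMap ℓ u = (a : ℚ_[ℓ]) • rationalTateModuleMap ℓ (toImage u) := by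
  rw [← rationalTateModuleMap_imageι_comp_toImage ℓ u, ← LinearMap.comp_assoc, rationalTateModuleMap_toImage_comp_imageι ℓ hu,
    LinearMap.smul_comp, LinearMap.id_comp]

/-- **`V_ℓ(X ↠ Im u)` is surjective** (right inverse `a⁻¹ · V_ℓ ι`, `a ≠ 0`). [cite: MumfordAV1970, §19 Thm. 3 (p. 176)] -/
theorem rationalTateModuleMap_toImage_surjective (hu : u ≫ u = a • u) (ha : a ≠ 0) :
    Function.Surjective (rationalTateModuleMap ℓ (toImage u)) := by
  intro y
  refine ⟨(a : ℚ_[ℓ])⁻¹ • rationalTateModuleMap ℓ (imageι u) y, ?_⟩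
  have h := LinearMap.congr_fun (rationalTateModuleMap_toImage_comp_imageι ℓ hu) y
  simp only [LinearMap.coe_comp, Function.comp_apply, LinearMap.smul_apply, LinearMap.id_apply] at h
  rw [map_smul, h, inv_smul_smul₀ (Nat.cast_ne_zero.2 ha)]

/-- **`ᵗV_ℓ(X ↠ Im u) : (V_ℓ Im u)^∨ → (V_ℓ X)^∨` is injective** (dual of a surjection). [cite: MumfordAV1970, §19 Thm. 3 (p. 176)] -/
theorem dualMap_rationalTateModuleMap_toImage_injective (hu : u ≫ u = a • u) (ha : a ≠ 0) :
    Function.Injective (rationalTateModuleMap ℓ (toImage u)).dualMap :=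
  LinearMap.dualMap_injective_of_surjective (rationalTateModuleMap_toImage_surjective ℓ hu ha)

/-! ## §2 The range of `ᵗV_ℓ ū` is the `a`-eigenspace of `ᵗV_ℓ u` -/

/-- **`range ᵗV_ℓ(X ↠ Im u) = a`-eigenspace of `ᵗV_ℓ u` on `(V_ℓ X)^∨`** (`u ≫ u = a • u`, `a ≠ 0`): a linear form `g` on `V_ℓ X`
factors through `V_ℓ ū` iff `g ∘ V_ℓ u = a · g` (iff `g ∘ V_ℓ(1 − u/a) = 0`); then `g = ᵗV_ℓ ū (a⁻¹ · ᵗV_ℓ ι g)`.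
[cite: MumfordAV1970, §19 Thm. 1 (p. 173) and Thm. 3 (p. 176)] [cite: Liu2021, App. D §D.4 (FJcycle.tex l. 5626–5627)] -/
theorem range_dualMap_rationalTateModuleMap_toImage (hu : u ≫ u = a • u) (ha : a ≠ 0) :
    LinearMap.range (rationalTateModuleMap ℓ (toImage u)).dualMap =
      Module.End.eigenspace (rationalTateModuleMap ℓ u).dualMap (a : ℚ_[ℓ]) := by
  have ha' : (a : ℚ_[ℓ]) ≠ 0 := Nat.cast_ne_zero.2 ha
  apply le_antisymm
  · rintro g ⟨h, rfl⟩
    rw [Module.End.mem_eigenspace_iff]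
    apply LinearMap.ext
    intro x
    simp only [LinearMap.dualMap_apply, LinearMap.smul_apply]
    have := LinearMap.congr_fun (rationalTateModuleMap_toImage_comp_self ℓ hu) x
    simp only [LinearMap.coe_comp, Function.comp_apply, LinearMap.smul_apply] at this
    rw [this, map_smul]
  · intro g hg
    rw [Module.End.mem_eigenspace_iff] at hg
    refine ⟨(a : ℚ_[ℓ])⁻¹ • (rationalTateModuleMap ℓ (imageι u)).dualMap g, ?_⟩
    rw [map_smul]
    apply LinearMap.ext
    intro x
    have hgx := LinearMap.congr_fun hg x
    simp only [LinearMap.dualMap_apply, LinearMap.smul_apply] at hgx ⊢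
    rw [← LinearMap.comp_apply (rationalTateModuleMap ℓ (imageι u)), rationalTateModuleMap_imageι_comp_toImage, hgx,
      inv_smul_smul₀ ha']

/-! ## §3 Equivariance for endomorphisms commuting with `u`, and the base-changed hand-over -/

/-- **`ᵗV_ℓ ū` intertwines `ᵗV_ℓ(b|_{Im u})` and `ᵗV_ℓ b`** for `b` commuting with `u` (`ū ≫ b| = b ≫ ū`, ★ `toImage_imageRestrict`).
[cite: MumfordAV1970, §19 Thm. 1 (p. 173)] -/
theorem dualMap_toImage_comp_dualMap_imageRestrict (b : X ⟶ X) (hb : b ≫ u = u ≫ b) :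
    (rationalTateModuleMap ℓ (toImage u)).dualMap ∘ₗ (rationalTateModuleMap ℓ (imageRestrict u b b hb)).dualMap =
      (rationalTateModuleMap ℓ b).dualMap ∘ₗ (rationalTateModuleMap ℓ (toImage u)).dualMap := by
  rw [LinearMap.dualMap_comp_dualMap, LinearMap.dualMap_comp_dualMap, ← rationalTateModuleMap_comp,
    ← rationalTateModuleMap_comp, toImage_imageRestrict]

/-- **`ᵗV_ℓ ι` intertwines `ᵗV_ℓ b` and `ᵗV_ℓ(b|_{Im u})`** (`b| ≫ ι = ι ≫ b`, ★ `imageRestrict_ι`). [cite: MumfordAV1970, §19 Thm. 1 (p. 173)] -/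
theorem dualMap_imageι_comp_dualMap (b : X ⟶ X) (hb : b ≫ u = u ≫ b) :
    (rationalTateModuleMap ℓ (imageι u)).dualMap ∘ₗ (rationalTateModuleMap ℓ b).dualMap =
      (rationalTateModuleMap ℓ (imageRestrict u b b hb)).dualMap ∘ₗ (rationalTateModuleMap ℓ (imageι u)).dualMap := by
  rw [LinearMap.dualMap_comp_dualMap, LinearMap.dualMap_comp_dualMap, ← rationalTateModuleMap_comp,
    ← rationalTateModuleMap_comp, imageRestrict_ι]

/-- **The hand-over, base-changed to any commutative `ℚ_ℓ`-algebra `R`** (e.g. `ℚ_ℓ^{ac}`): a class `G ∈ R ⊗ (V_ℓ X)^∨` in the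
`a`-eigenspace of `1 ⊗ ᵗV_ℓ u` is `(1 ⊗ ᵗV_ℓ ū) F` for `F := a⁻¹ · (1 ⊗ ᵗV_ℓ ι) G ∈ R ⊗ (V_ℓ Im u)^∨`, and EVERY eigen-relation
`(1 ⊗ ᵗV_ℓ b) G = c • G` for an endomorphism `b` commuting with `u` descends to `(1 ⊗ ᵗV_ℓ(b|_{Im u})) F = c • F`.  This is the
`(φ := ū, f := F)` input of the CM step of [Liu2021] Thm. D.6 (1) («a surjective homomorphism `φ : A_K → B` … `φ^*` an isomorphism onto
`H¹(A_K)[π̲^∞]`»).  (Only `ū ≫ ι = u` and `a ≠ 0` are used here; quasi-idempotency `u ≫ u = a • u` is what makes the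
`a`-eigenspace the whole range, §2.) [cite: Liu2021, App. D §D.4 (FJcycle.tex l. 5626–5627)] [cite: MumfordAV1970, §19 Thm. 1 (p. 173) and Thm. 3 (p. 176)] -/
theorem exists_eq_dualMap_toImage_baseChange_of_mem_eigenspace (u : X ⟶ X) (ha : a ≠ 0)
    (R : Type*) [CommRing R] [Algebra ℚ_[ℓ] R] (G : R ⊗[ℚ_[ℓ]] Module.Dual ℚ_[ℓ] (X.rationalTateModule ℓ))
    (hG : ((rationalTateModuleMap ℓ u).dualMap).baseChange R G = (a : ℚ_[ℓ]) • G) :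
    ∃ F : R ⊗[ℚ_[ℓ]] Module.Dual ℚ_[ℓ] ((image u).rationalTateModule ℓ),
      ((rationalTateModuleMap ℓ (toImage u)).dualMap).baseChange R F = G ∧
      ∀ (b : X ⟶ X) (hb : b ≫ u = u ≫ b) (c : R), ((rationalTateModuleMap ℓ b).dualMap).baseChange R G = c • G →
        ((rationalTateModuleMap ℓ (imageRestrict u b b hb)).dualMap).baseChange R F = c • F := by
  have ha' : (a : ℚ_[ℓ]) ≠ 0 := Nat.cast_ne_zero.2 ha
  -- `(1 ⊗ ᵗū) ((1 ⊗ ᵗι) G) = (1 ⊗ ᵗu) G = a • G`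
  have hfac : ((rationalTateModuleMap ℓ (toImage u)).dualMap).baseChange R
      (((rationalTateModuleMap ℓ (imageι u)).dualMap).baseChange R G) = (a : ℚ_[ℓ]) • G := by
    have hcomp : (rationalTateModuleMap ℓ (toImage u)).dualMap ∘ₗ (rationalTateModuleMap ℓ (imageι u)).dualMap =
        (rationalTateModuleMap ℓ u).dualMap := by
      rw [LinearMap.dualMap_comp_dualMap, rationalTateModuleMap_imageι_comp_toImage]
    have := congrArg (fun (L : Module.Dual ℚ_[ℓ] (X.rationalTateModule ℓ) →ₗ[ℚ_[ℓ]] _) => (L.baseChange R) G) hcomp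
    simpa only [LinearMap.baseChange_comp, LinearMap.comp_apply, hG] using this
  refine ⟨(a : ℚ_[ℓ])⁻¹ • ((rationalTateModuleMap ℓ (imageι u)).dualMap).baseChange R G, ?_, fun b hb c hc => ?_⟩
  · rw [LinearMap.map_smul_of_tower, hfac, inv_smul_smul₀ ha']
  · -- `(1 ⊗ ᵗ(b|)) ((1 ⊗ ᵗι) G) = (1 ⊗ ᵗι) ((1 ⊗ ᵗb) G) = c • (1 ⊗ ᵗι) G`
    have hcomm := congrArg (fun (L : Module.Dual ℚ_[ℓ] (X.rationalTateModule ℓ) →ₗ[ℚ_[ℓ]] _) => (L.baseChange R) G)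
      (dualMap_imageι_comp_dualMap ℓ b hb)
    simp only [LinearMap.baseChange_comp, LinearMap.comp_apply, hc, map_smul] at hcomm
    rw [LinearMap.map_smul_of_tower, ← hcomm, smul_comm]

end AbelianVariety

end Literature.AlgebraicGeometry.Motives

end
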